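import Mathlib
import Literature.NumberTheory.LFunctions.Zhang2022.Section8RangeEngine
import Literature.NumberTheory.LFunctions.Zhang2022.Section8PrintedConstants
import HarnessLib

/-!
# Zhang (2022) §8: (8.11) from the substituted display via the range-sum engine — `Section8cStatements.Ded811` (SUPPLEMENTARY route)

Topic `Literature/NumberTheory/LFunctions/Zhang2022` (Landau–Siegel audit tree; verdict-neutral).
D-0069 campaign, cell `siegel-zhang`, DISCHARGE board row **D01** (cone C22, `Skeleton.Ded823`
chain), node `Z22:(8.11)` = the typed deduction `Section8cStatements.Ded811 c′ : Step8u046 c′ →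
Step8u047 c′ → Step8u048 → Eq811 c′` ("Since … it follows by partial integration that (8.11)",
[Z22 p.48, tex L2452–L2469]). Y. Zhang, *Discrete mean estimates and the Landau–Siegel zero*,
arXiv:2211.02515v1 (2022) [Zhang2022LandauSiegel] — **an unrefereed manuscript under adjudication;
this file proves an implication between the manuscript's typed nodes and asserts nothing about its
Theorems 1–2 or about Landau–Siegel zeros.** Theorem-only (no definitions, no facts, no numerics).
Seats: sz-d29 (this file, on the range-sum engine `Section8RangeEngine` p415617 and the profile
calculus `Section8AbelProfiles` p414192) with the inputs of seat d16 (`Z22:§8.u047`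
`Section8cProofs.step8u047_holds`; the `[T, 1.2.12]` mean value in the polynomial-error form). The
node's holder (seat d16) lands an independent four-file proof under the namespace `…Section8Ded811`
(`Section8Ded811Prelims` p416328, …); this file is the SUPPLEMENTARY engine route, namespace
`…Section8Ded811Engine`, same two closing statements.

| decl | content |
|---|---|
| `theta2_mem`, `log_P1_P2` | `θ₂ ∈ [0.4, 0.5]` (`𝓛 ≥ 2`); `log P₁ = 0.504𝓛⁹`, `log P₂ = θ₂𝓛⁹` |
| `S811_eq_integrals` | `S811(𝓕_{j6},𝓕_{j7},𝓖_{j6},𝓖_{j7}; 𝓛⁹, 0.504, θ₂) = ∫₁^{P₂} mFac·nFac dt/t + ∫_{P₂}^{P₁} diagFac dt/t` |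
| `kappa_le`, `alpha_log_succ_P1_le`, `errF_le`, `errG_le`, `total_err_le` | the numeric bookkeeping (`κ ≤ 10𝓛⁻⁹`, `α log(P₁+1) ≤ 4`, engine errors `≤ |C|Q𝓛⁻¹² ≤ (ε/2)α`) |
| `eq811_of_step8u046` | **`Step8u046 c′ → Eq811 c′`**: the engine at `F = mFac·nFac` on `[1,P₂]` and at `G = diagFac` on `[1,P₁]`, `[1,P₂]`; total error `O(𝓛⁻¹²) = o(α)` |
| `ded811_holds` | **`Section8cStatements.Ded811 c′`** (its `Step8u047`/`Step8u048` antecedents are not needed: the engine consumes the kernel theorems instead of the printed `O(log 𝓛)` form) |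

WHAT THIS FILE IS NOT: a proof of `Step8u046` (⇐ `Step8u044` "simple approximation", seat d20, +
(8.10)); not a statement about (8.24) or about Theorems 1–2 / Landau–Siegel zeros.

## References

* Y. Zhang, arXiv:2211.02515v1 (2022), §8 p.48, (8.11), tex L2452–L2469; §2 (2.21), (2.26),
  (2.31). [cite: Zhang2022LandauSiegel, §8 (8.11) p.48]
-/

noncomputable section

open Complex Real ComplexConjugate Set MeasureTheory Finset

namespace Literature.NumberTheory.LFunctions.Zhang2022.Section8Ded811Engine

open Skeleton Section8cStatements Section8AbelProfiles Section8RangeEngine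

/-! ### The scales -/

/-- `θ₂ = 0.5 − 10𝓛^{1.1}/𝓛⁹ ∈ [0.4, 0.5]` once `𝓛 ≥ 2` (so `log P₂ = θ₂𝓛⁹ ≍ 𝓛⁹`).
[cite: Zhang2022LandauSiegel, §2 (2.21)] -/
theorem theta2_mem {D : ℕ} (hℓ : 2 ≤ ell D) : 0.4 ≤ theta2 D ∧ theta2 D ≤ 0.5 := by
  have hℓ1 : 1 ≤ ell D := by linarith
  have hℓ0 : 0 < ell D := by linarith
  have h11 : ell D ^ (1.1 : ℝ) ≤ ell D ^ 2 := by
    rw [← Real.rpow_natCast _ 2]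
    exact Real.rpow_le_rpow_of_exponent_le hℓ1 (by norm_num)
  have h0 : 0 ≤ ell D ^ (1.1 : ℝ) := by positivity
  have h7 : (2 : ℝ) ^ 7 ≤ ell D ^ 7 := pow_le_pow_left₀ (by norm_num) hℓ 7
  have h9 : 0 < ell D ^ 9 := by positivity
  unfold theta2
  constructor
  · -- `10𝓛^{1.1}/𝓛⁹ ≤ 10𝓛²/𝓛⁹ = 10/𝓛⁷ ≤ 0.1`
    have : 10 * ell D ^ (1.1 : ℝ) / ell D ^ 9 ≤ 0.1 := by
      rw [div_le_iff₀ h9]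
      have e9 : ell D ^ 9 = ell D ^ 2 * ell D ^ 7 := by ring
      rw [e9]
      nlinarith [h11, h7, sq_nonneg (ell D)]
    linarith
  · have : 0 ≤ 10 * ell D ^ (1.1 : ℝ) / ell D ^ 9 := by positivity
    linarith

/-- `log P₁ = 0.504𝓛⁹` and `log P₂ = θ₂𝓛⁹` ((2.21); `𝓛 ≠ 0` for the second).
[cite: Zhang2022LandauSiegel, §2 (2.21)] -/
theorem log_P1_P2 {D : ℕ} (hD : ell D ≠ 0) :
    Real.log (Skeleton.P1 D) = 0.504 * ell D ^ 9 ∧ Real.log (Skeleton.P2 D) = theta2 D * ell D ^ 9 := by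
  constructor
  · rw [← Ppow_theta1, log_Ppow]; ring
  · rw [← Ppow_theta2 D hD, log_Ppow]; ring

/-- **`S811` at the manuscript's scales is the sum of the two `(8.11)` integrals of the typed
profiles**: `S811(𝓕_{j6},𝓕_{j7},𝓖_{j6},𝓖_{j7}; 𝓛⁹, 0.504, θ₂)
= ∫₁^{P₂} mFac·nFac dt/t + ∫_{P₂}^{P₁} diagFac dt/t` (`Section8cStatements.mFac/nFac/diagFac`).
[cite: Zhang2022LandauSiegel, §8 (8.11) p.48, tex L2467] -/
theorem S811_eq_integrals (c' : ℝ) {D : ℕ} (hD : ell D ≠ 0) (j : ℕ) :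
    S811 (frakfW c' D j 6) (frakfW c' D j 7) (frakgW c' D j 6) (frakgW c' D j 7)
        (ell D ^ 9) 0.504 (theta2 D) =
      (∫ t in (1 : ℝ)..Skeleton.P2 D, mFac c' D j t * nFac c' D j t / t) +
        ∫ t in Skeleton.P2 D..Skeleton.P1 D, diagFac c' D j t / t := by
  unfold S811
  rw [Ppow_theta1, Ppow_theta2 D hD]
  congr 1
  · rw [← intervalIntegral.integral_const_mul]
    refine intervalIntegral.integral_congr fun x _ => ?_
    simp only [diagFac]
    ring

/-! ### Numeric bookkeeping (kept outside the main proof) -/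

/-- `κ = 1/log P₁ + ‖ι₂‖/log P₂ ≤ 10/𝓛⁹` (`log P₁ = 0.504𝓛⁹`, `log P₂ = θ₂𝓛⁹`, `θ₂ ≥ 0.4`,
`‖ι₂‖ ≤ 1.68346`). [cite: Zhang2022LandauSiegel, §2 (2.21), (2.26)] -/
theorem kappa_le {ℓ θ : ℝ} (hℓ : 3 ≤ ℓ) (hθ : 0.4 ≤ θ) :
    1 / (0.504 * ℓ ^ 9) + ‖iota2‖ / (θ * ℓ ^ 9) ≤ 10 / ℓ ^ 9 := by
  have h9 : 0 < ℓ ^ 9 := by positivity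
  have hι := norm_iota2_le
  have hι0 := norm_nonneg iota2
  have h1 : 1 / (0.504 * ℓ ^ 9) ≤ 2 / ℓ ^ 9 := by
    rw [div_le_div_iff₀ (by positivity) h9]; nlinarith
  have h2 : ‖iota2‖ / (θ * ℓ ^ 9) ≤ 5 / ℓ ^ 9 := by
    rw [div_le_div_iff₀ (by positivity) h9]; nlinarith
  have : 2 / ℓ ^ 9 + 5 / ℓ ^ 9 ≤ 10 / ℓ ^ 9 := by
    rw [← add_div]; exact div_le_div_of_nonneg_right (by norm_num) h9.le
  linarith

/-- `α log(P₁ + 1) ≤ 4` (`α = π/𝓛⁹`, `log P₁ = 0.504𝓛⁹`, `𝓛 ≥ 3`). [cite: Zhang2022LandauSiegel, §2 (2.10), (2.21)] -/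
theorem alpha_log_succ_P1_le {ℓ P1 : ℝ} (hℓ : 3 ≤ ℓ) (hP1 : 0 < P1) (hlog : Real.log P1 = 0.504 * ℓ ^ 9)
    (hP1' : 1 ≤ P1) : π / ℓ ^ 9 * Real.log (P1 + 1) ≤ 4 := by
  have h9 : 0 < ℓ ^ 9 := by positivity
  have h9' : (3 : ℝ) ^ 9 ≤ ℓ ^ 9 := pow_le_pow_left₀ (by norm_num) hℓ 9
  have hlog2 : Real.log (P1 + 1) ≤ 1 + 0.504 * ℓ ^ 9 := by
    have h1 : P1 + 1 ≤ 2 * P1 := by linarith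
    have h2 : Real.log (P1 + 1) ≤ Real.log (2 * P1) := Real.log_le_log (by linarith) h1
    rw [Real.log_mul (by norm_num) hP1.ne', hlog] at h2
    have h3 : Real.log 2 ≤ 1 := by have := Real.log_two_lt_d9; linarith
    linarith
  have hπ4 : π ≤ 4 := by have := Real.pi_lt_d2; linarith
  rw [div_mul_eq_mul_div, div_le_iff₀ h9]
  have hlog0 : 0 ≤ Real.log (P1 + 1) := Real.log_nonneg (by linarith)
  calc π * Real.log (P1 + 1) ≤ 4 * (1 + 0.504 * ℓ ^ 9) := by nlinarith [Real.pi_pos]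
    _ ≤ 4 * ℓ ^ 9 := by nlinarith

/-- The `F = mFac·nFac` engine error: `C𝓛⁶(M + M′𝓛⁹) ≤ |C|(423400 + 2674500π)𝓛⁻¹²` for
`M = 29κ·146κ`, `M′ = 94ακ·146κ + 29κ·449ακ`, `κ ≤ 10𝓛⁻⁹`, `α = π𝓛⁻⁹`.
[cite: Zhang2022LandauSiegel, §8 (8.11) p.48] -/
theorem errF_le {ℓ κ C : ℝ} (hℓ : 3 ≤ ℓ) (hκ0 : 0 ≤ κ) (hκ : κ ≤ 10 / ℓ ^ 9) :
    C * ℓ ^ 6 * (29 * κ * (146 * κ) +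
        (94 * (π / ℓ ^ 9) * κ * (146 * κ) + 29 * κ * (449 * (π / ℓ ^ 9) * κ)) * ℓ ^ 9) ≤
      |C| * (423400 + 2674500 * π) / ℓ ^ 12 := by
  have hℓ0 : 0 < ℓ := by linarith
  have h9 : 0 < ℓ ^ 9 := by positivity
  have hκ2 : κ ^ 2 ≤ 100 / ℓ ^ 18 := by
    calc κ ^ 2 ≤ (10 / ℓ ^ 9) ^ 2 := pow_le_pow_left₀ hκ0 hκ 2
      _ = 100 / ℓ ^ 18 := by rw [div_pow]; ring
  have e : C * ℓ ^ 6 * (29 * κ * (146 * κ) +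
        (94 * (π / ℓ ^ 9) * κ * (146 * κ) + 29 * κ * (449 * (π / ℓ ^ 9) * κ)) * ℓ ^ 9) =
      C * ((4234 + 26745 * π) * (ℓ ^ 6 * κ ^ 2)) := by
    field_simp
    ring
  rw [e]
  have hx0 : 0 ≤ (4234 + 26745 * π) * (ℓ ^ 6 * κ ^ 2) := by positivity
  have hx : (4234 + 26745 * π) * (ℓ ^ 6 * κ ^ 2) ≤ (423400 + 2674500 * π) / ℓ ^ 12 := by
    have h1 : ℓ ^ 6 * κ ^ 2 ≤ ℓ ^ 6 * (100 / ℓ ^ 18) := mul_le_mul_of_nonneg_left hκ2 (by positivity)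
    have h2 : ℓ ^ 6 * (100 / ℓ ^ 18) = 100 / ℓ ^ 12 := by field_simp
    calc (4234 + 26745 * π) * (ℓ ^ 6 * κ ^ 2) ≤ (4234 + 26745 * π) * (100 / ℓ ^ 12) := by
          rw [← h2]; exact mul_le_mul_of_nonneg_left h1 (by positivity)
      _ = (423400 + 2674500 * π) / ℓ ^ 12 := by ring
  calc C * ((4234 + 26745 * π) * (ℓ ^ 6 * κ ^ 2)) ≤ |C| * ((4234 + 26745 * π) * (ℓ ^ 6 * κ ^ 2)) :=
        mul_le_mul_of_nonneg_right (le_abs_self C) hx0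
    _ ≤ |C| * ((423400 + 2674500 * π) / ℓ ^ 12) := mul_le_mul_of_nonneg_left hx (abs_nonneg C)
    _ = |C| * (423400 + 2674500 * π) / ℓ ^ 12 := by ring

/-- The `G = diagFac` engine error: `C𝓛⁶(M + M′𝓛⁹) ≤ |C|(16936 + 106980π)𝓛⁻¹²` for
`M = 4234/L₁²`, `M′ = 26745α/L₁²`, `L₁ = 0.504𝓛⁹`, `α = π𝓛⁻⁹`.
[cite: Zhang2022LandauSiegel, §8 (8.11) p.48] -/
theorem errG_le {ℓ L1 C : ℝ} (hℓ : 3 ≤ ℓ) (hL1 : L1 = 0.504 * ℓ ^ 9) :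
    C * ℓ ^ 6 * (4234 / L1 ^ 2 + 26745 * (π / ℓ ^ 9) / L1 ^ 2 * ℓ ^ 9) ≤
      |C| * (16936 + 106980 * π) / ℓ ^ 12 := by
  have hℓ0 : 0 < ℓ := by linarith
  have h9 : 0 < ℓ ^ 9 := by positivity
  have hL1pos : 0 < L1 := by rw [hL1]; positivity
  have hinv : 1 / L1 ^ 2 ≤ 4 / ℓ ^ 18 := by
    rw [hL1, div_le_div_iff₀ (by positivity) (by positivity)]
    have : (0.504 * ℓ ^ 9) ^ 2 = 0.254016 * ℓ ^ 18 := by ring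
    rw [this]; nlinarith [pow_pos hℓ0 18]
  have e : C * ℓ ^ 6 * (4234 / L1 ^ 2 + 26745 * (π / ℓ ^ 9) / L1 ^ 2 * ℓ ^ 9) =
      C * ((4234 + 26745 * π) * (ℓ ^ 6 * (1 / L1 ^ 2))) := by
    field_simp
  rw [e]
  have hx0 : 0 ≤ (4234 + 26745 * π) * (ℓ ^ 6 * (1 / L1 ^ 2)) := by positivity
  have hx : (4234 + 26745 * π) * (ℓ ^ 6 * (1 / L1 ^ 2)) ≤ (16936 + 106980 * π) / ℓ ^ 12 := by
    have h1 : ℓ ^ 6 * (1 / L1 ^ 2) ≤ ℓ ^ 6 * (4 / ℓ ^ 18) := mul_le_mul_of_nonneg_left hinv (by positivity)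
    have h2 : ℓ ^ 6 * (4 / ℓ ^ 18) = 4 / ℓ ^ 12 := by field_simp
    calc (4234 + 26745 * π) * (ℓ ^ 6 * (1 / L1 ^ 2)) ≤ (4234 + 26745 * π) * (4 / ℓ ^ 12) := by
          rw [← h2]; exact mul_le_mul_of_nonneg_left h1 (by positivity)
      _ = (16936 + 106980 * π) / ℓ ^ 12 := by ring
  calc C * ((4234 + 26745 * π) * (ℓ ^ 6 * (1 / L1 ^ 2)))
      ≤ |C| * ((4234 + 26745 * π) * (ℓ ^ 6 * (1 / L1 ^ 2))) :=
        mul_le_mul_of_nonneg_right (le_abs_self C) hx0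
    _ ≤ |C| * ((16936 + 106980 * π) / ℓ ^ 12) := mul_le_mul_of_nonneg_left hx (abs_nonneg C)
    _ = |C| * (16936 + 106980 * π) / ℓ ^ 12 := by ring

/-- The total engine error `|C|·Q·𝓛⁻¹²` is `≤ (ε/2)·α` once `𝓛 ≥ 2|C|Q/(επ)` (`α = π𝓛⁻⁹`, `𝓛 ≥ 3`).
[cite: Zhang2022LandauSiegel, §8 (8.11) p.48] -/
theorem total_err_le {ℓ C Q ε : ℝ} (hℓ : 3 ≤ ℓ) (hε : 0 < ε)
    (hCQ : 2 * |C| * Q / (ε * π) ≤ ℓ) : |C| * Q / ℓ ^ 12 ≤ ε / 2 * (π / ℓ ^ 9) := by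
  have hℓ0 : 0 < ℓ := by linarith
  have hℓ1 : 1 ≤ ℓ := by linarith
  have h3 : ℓ ≤ ℓ ^ 3 := le_self_pow₀ hℓ1 (by norm_num)
  have hCQ' : 2 * |C| * Q ≤ ε * π * ℓ ^ 3 := by
    have := (div_le_iff₀ (by positivity)).mp hCQ
    nlinarith [this, h3, mul_pos hε Real.pi_pos]
  rw [div_le_iff₀ (by positivity)]
  have e : ε / 2 * (π / ℓ ^ 9) * ℓ ^ 12 = ε * π * ℓ ^ 3 / 2 := by field_simp
  rw [e]
  linarith

/-! ### The main theorem: (8.11) from the substituted display -/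

/-- **`Z22:(8.11)` from `Z22:§8.u046` ("it follows by partial integration that"), in the kernel.**
The substituted display `Step8u046` (`S_j(𝐚₁₁,𝐚₂₁) = L′(1,χ)²[Σ_{n<P₂}|χ|λ₀ⱼφ⁻¹·mFac·nFac +
Σ_{P₂≤n<P₁}|χ|λ₀ⱼφ⁻¹·diagFac] + o(α)`) implies (8.11) (`Eq811`: `S_j = 𝔞·S811 + o(α)`), by the
range-sum engine `Section8RangeEngine.weighted_sum_integral_eval` applied to `F = mFac·nFac` on
`[1,P₂]` and to `G = diagFac` on `[1,P₁]` and `[1,P₂]` (difference = the range `[P₂,P₁)`), with the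
profile bounds of `Section8AbelProfiles` (`‖F‖ ≍ 𝓛⁻¹⁸`, `‖F′‖ ≍ α𝓛⁻¹⁸/t`): total error `O(𝓛⁻¹²) = o(α)`.
The inputs `λ₀ⱼ = φ²/n² + O(α𝓛)` (u047) and the `[T,1.2.12]` mean value (u048, in the polynomial-error
form the tree proves) are consumed inside the engine, so the typed `Ded811` follows with its u047/u048
antecedents unused. [cite: Zhang2022LandauSiegel, §8 (8.11) p.48, tex L2452–L2469] -/
theorem eq811_of_step8u046 (c' : ℝ) (h46 : Step8u046 c') : Eq811 c' := by
  intro ε hε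
  obtain ⟨C, hE⟩ := weighted_sum_integral_eval c'
  set Q : ℝ := (423400 + 2674500 * π) + 2 * (16936 + 106980 * π) with hQ
  have FL : ForAllLarge fun D _ _ =>
      3 ≤ ell D ∧ 5 * |c'| * π ≤ ell D ∧ 2 * |C| * Q / (ε * π) ≤ ell D :=
    ForAllLarge.of_le (max 21 (max ⌈Real.exp (5 * |c'| * π)⌉₊ ⌈Real.exp (2 * |C| * Q / (ε * π))⌉₊))
      fun D _ _ hD _ _ =>
        ⟨Section8Ded823.three_le_ell (le_trans (le_max_left _ _) hD),
          Section8Ded823.le_ell_of_le (le_trans ((le_max_left _ _).trans (le_max_right _ _)) hD),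
          Section8Ded823.le_ell_of_le (le_trans ((le_max_right _ _).trans (le_max_right _ _)) hD)⟩
  refine (((h46 (ε / 2) (by positivity)).and hE).and FL).mono ?_
  intro D _ χ hq hp h hA j hj
  obtain ⟨⟨e46, eng⟩, hℓ3, hc5, hCQ⟩ := h
  replace e46 := e46 hA j hj
  replace eng := eng j hj
  -- parameters
  have hℓ0 : 0 < ell D := by linarith
  have hℓ1 : 1 ≤ ell D := by linarith
  have hℓne : ell D ≠ 0 := hℓ0.ne'
  have h9 : 0 < ell D ^ 9 := by positivity
  have hα : alpha D = π / ell D ^ 9 := by rw [Skeleton.alpha, log_bigP]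
  have hα0 : 0 < alpha D := by rw [hα]; positivity
  have hc : 5 * |c'| * alpha D * ell D ≤ 1 := by
    have h8 : ell D ≤ ell D ^ 8 := le_self_pow₀ hℓ1 (by norm_num)
    have e : 5 * |c'| * alpha D * ell D = 5 * |c'| * π / ell D ^ 8 := by
      rw [hα]; field_simp
    rw [e, div_le_one (by positivity)]
    linarith
  obtain ⟨hL1, hL2⟩ := log_P1_P2 hℓne (D := D)
  obtain ⟨hθ1, hθ2⟩ := theta2_mem (by linarith : 2 ≤ ell D)
  have hP1pos : 0 < Skeleton.P1 D := by rw [← Ppow_theta1]; exact Ppow_pos _ _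
  have hP2pos : 0 < Skeleton.P2 D := by rw [← Ppow_theta2 D hℓne]; exact Ppow_pos _ _
  have hlogP1 : 0 < Real.log (Skeleton.P1 D) := by rw [hL1]; positivity
  have hlogP2 : 0 < Real.log (Skeleton.P2 D) := by rw [hL2]; positivity
  have h39 : (3 : ℝ) ^ 9 ≤ ell D ^ 9 := pow_le_pow_left₀ (by norm_num) hℓ3 9
  have hP2two : 2 ≤ Skeleton.P2 D := by
    have h1 : (1 : ℝ) ≤ Real.log (Skeleton.P2 D) := by rw [hL2]; nlinarith
    have h2 : Real.exp 1 ≤ Skeleton.P2 D := by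
      rw [← Real.exp_log hP2pos]; exact Real.exp_le_exp.mpr h1
    have h3 : (2 : ℝ) ≤ Real.exp 1 := by have := Real.exp_one_gt_d9; linarith
    linarith
  have hP21 : Skeleton.P2 D ≤ Skeleton.P1 D := by
    rw [← Real.log_le_log_iff hP2pos hP1pos, hL1, hL2]; nlinarith
  have hP1two : 2 ≤ Skeleton.P1 D := le_trans hP2two hP21
  have hP1P : Skeleton.P1 D ≤ bigP D := by
    have hPpos : 0 < bigP D := Real.exp_pos _
    rw [← Real.log_le_log_iff hP1pos hPpos, hL1, log_bigP]; nlinarith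
  have hP2P : Skeleton.P2 D ≤ bigP D := hP21.trans hP1P
  set T : ℝ := Skeleton.P1 D + 1 with hT
  have hTα : alpha D * Real.log T ≤ 4 := by
    rw [hα]; exact alpha_log_succ_P1_le hℓ3 hP1pos hL1 (by linarith)
  set κ : ℝ := 1 / Real.log (Skeleton.P1 D) + ‖iota2‖ / Real.log (Skeleton.P2 D) with hκ
  have hκ0 : 0 ≤ κ := by positivity
  have hκ10 : κ ≤ 10 / ell D ^ 9 := by rw [hκ, hL1, hL2]; exact kappa_le hℓ3 hθ1
  -- the two profiles and their bounds on `[1, T]`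
  set FF : ℝ → ℂ := fun u => mFac c' D j u * nFac c' D j u with hFF
  have bF : ∀ t ∈ Set.Icc 1 T, DifferentiableAt ℝ FF t ∧ ‖FF t‖ ≤ 29 * κ * (146 * κ) ∧
      ‖deriv FF t‖ ≤ (94 * alpha D * κ * (146 * κ) + 29 * κ * (449 * alpha D * κ)) / t := by
    intro t ht
    obtain ⟨dm, nm, nm'⟩ := mFac_bounds c' j hα0 hℓ0.le hc (by linarith) (by linarith) (le_of_lt (by
      rw [hT]; linarith)) (by rw [hT]; linarith) ht.1 ht.2 hTα hlogP1 hlogP2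
    obtain ⟨dn, nn, nn'⟩ := nFac_bounds c' j hα0 hℓ0.le hc (by linarith) (by linarith) (le_of_lt (by
      rw [hT]; linarith)) (by rw [hT]; linarith) ht.1 ht.2 hTα hlogP1 hlogP2
    exact mul_bounds dm dn nm nn nm' nn' (by positivity)
  have bG : ∀ t ∈ Set.Icc 1 T, DifferentiableAt ℝ (diagFac c' D j) t ∧
      ‖diagFac c' D j t‖ ≤ 4234 / Real.log (Skeleton.P1 D) ^ 2 ∧
      ‖deriv (diagFac c' D j) t‖ ≤ 26745 * alpha D / Real.log (Skeleton.P1 D) ^ 2 / t :=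
    fun t ht => diagFac_bounds c' j hα0 hℓ0.le hc (by linarith) (le_of_lt (by rw [hT]; linarith))
      ht.1 ht.2 hTα hlogP1
  -- the three engine applications
  have engF := eng (Skeleton.P2 D) (29 * κ * (146 * κ))
    (94 * alpha D * κ * (146 * κ) + 29 * κ * (449 * alpha D * κ)) FF hP2two hP2P (by positivity)
    (by positivity) (fun t ht => (bF t ⟨ht.1, by rw [hT]; linarith [ht.2]⟩).1)
    (fun t ht => (bF t ⟨ht.1, by rw [hT]; linarith [ht.2]⟩).2.1)
    (fun t ht => (bF t ⟨ht.1, by rw [hT]; linarith [ht.2]⟩).2.2)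
  have engG1 := eng (Skeleton.P1 D) (4234 / Real.log (Skeleton.P1 D) ^ 2)
    (26745 * alpha D / Real.log (Skeleton.P1 D) ^ 2) (diagFac c' D j) hP1two hP1P (by positivity)
    (by positivity) (fun t ht => (bG t ⟨ht.1, by rw [hT]; linarith [ht.2]⟩).1)
    (fun t ht => (bG t ⟨ht.1, by rw [hT]; linarith [ht.2]⟩).2.1)
    (fun t ht => (bG t ⟨ht.1, by rw [hT]; linarith [ht.2]⟩).2.2)
  have engG2 := eng (Skeleton.P2 D) (4234 / Real.log (Skeleton.P1 D) ^ 2)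
    (26745 * alpha D / Real.log (Skeleton.P1 D) ^ 2) (diagFac c' D j) hP2two hP2P (by positivity)
    (by positivity) (fun t ht => (bG t ⟨ht.1, by rw [hT]; linarith [ht.2]⟩).1)
    (fun t ht => (bG t ⟨ht.1, by rw [hT]; linarith [ht.2]⟩).2.1)
    (fun t ht => (bG t ⟨ht.1, by rw [hT]; linarith [ht.2]⟩).2.2)
  -- numeric size of the three errors
  have errF := errF_le (C := C) hℓ3 hκ0 hκ10
  have errG := errG_le (C := C) hℓ3 hL1
  rw [← hα] at errF errG
  have htot := total_err_le hℓ3 hε hCQ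
  -- names
  set L2 : ℂ := deriv χ.LFunction 1 ^ 2 with hL2def
  set w : ℕ → ℂ := fun n => (‖χ (n : ZMod D)‖ : ℂ) * lamZero c' D j n / (Nat.totient n : ℂ) with hw
  set N1 : ℕ := ⌈Skeleton.P1 D⌉₊ with hN1
  set N2 : ℕ := ⌈Skeleton.P2 D⌉₊ with hN2
  have hN12 : N2 ≤ N1 := Nat.ceil_mono hP21
  have hN2one : 1 ≤ N2 := Nat.one_le_ceil_iff.mpr (by linarith)
  set SF : ℂ := ∑ n ∈ Finset.Ico 1 N2, w n * FF n with hSF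
  set SG1 : ℂ := ∑ n ∈ Finset.Ico 1 N1, w n * diagFac c' D j n with hSG1
  set SG2 : ℂ := ∑ n ∈ Finset.Ico 1 N2, w n * diagFac c' D j n with hSG2
  set SG : ℂ := ∑ n ∈ Finset.Ico N2 N1, w n * diagFac c' D j n with hSG
  set IF : ℂ := ∫ t in (1 : ℝ)..Skeleton.P2 D, FF t / t with hIF
  set IG1 : ℂ := ∫ t in (1 : ℝ)..Skeleton.P1 D, diagFac c' D j t / t with hIG1
  set IG2 : ℂ := ∫ t in (1 : ℝ)..Skeleton.P2 D, diagFac c' D j t / t with hIG2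
  set IG : ℂ := ∫ t in Skeleton.P2 D..Skeleton.P1 D, diagFac c' D j t / t with hIG
  have hSG_split : SG = SG1 - SG2 := by
    rw [hSG, hSG1, hSG2, ← Finset.sum_Ico_consecutive _ hN2one hN12]
    ring
  have hGcont : ContinuousOn (fun t : ℝ => diagFac c' D j t / (t : ℂ)) (Set.Icc 1 T) := by
    refine ContinuousOn.div (fun t ht => (bG t ht).1.continuousAt.continuousWithinAt)
      Complex.continuous_ofReal.continuousOn fun t ht => ?_
    exact_mod_cast (by linarith [ht.1] : t ≠ 0)
  have hIG_split : IG = IG1 - IG2 := by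
    rw [hIG, hIG1, hIG2, intervalIntegral.integral_interval_sub_left]
    · exact (hGcont.mono fun t ht => by
        rw [Set.uIcc_of_le (by linarith : (1:ℝ) ≤ Skeleton.P1 D)] at ht
        exact ⟨ht.1, by rw [hT]; linarith [ht.2]⟩).intervalIntegrable
    · exact (hGcont.mono fun t ht => by
        rw [Set.uIcc_of_le (by linarith : (1:ℝ) ≤ Skeleton.P2 D)] at ht
        exact ⟨ht.1, by rw [hT]; linarith [ht.2]⟩).intervalIntegrable
  -- the target
  rw [S811_eq_integrals c' hℓne j]
  have e46' : ‖Sj c' D j (a11 χ) (a21 χ) - (L2 * SF + L2 * SG)‖ ≤ ε / 2 * alpha D := by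
    have := e46
    simpa only [hL2def, hSF, hSG, hw, hFF, hN1, hN2] using this
  have key : Sj c' D j (a11 χ) (a21 χ) - (frakA χ : ℂ) * (IF + IG) =
      (Sj c' D j (a11 χ) (a21 χ) - (L2 * SF + L2 * SG)) + (L2 * SF - (frakA χ : ℂ) * IF) +
        ((L2 * SG1 - (frakA χ : ℂ) * IG1) - (L2 * SG2 - (frakA χ : ℂ) * IG2)) := by
    rw [hSG_split, hIG_split]; ring
  have engF' : ‖L2 * SF - (frakA χ : ℂ) * IF‖ ≤ |C| * (423400 + 2674500 * π) / ell D ^ 12 :=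
    engF.trans errF
  have engG1' : ‖L2 * SG1 - (frakA χ : ℂ) * IG1‖ ≤ |C| * (16936 + 106980 * π) / ell D ^ 12 :=
    engG1.trans errG
  have engG2' : ‖L2 * SG2 - (frakA χ : ℂ) * IG2‖ ≤ |C| * (16936 + 106980 * π) / ell D ^ 12 :=
    engG2.trans errG
  have hIFG : IF + IG = (∫ t in (1 : ℝ)..Skeleton.P2 D, mFac c' D j t * nFac c' D j t / t) +
      ∫ t in Skeleton.P2 D..Skeleton.P1 D, diagFac c' D j t / t := by rw [hIF, hIG]
  rw [← hIFG, key]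
  calc ‖(Sj c' D j (a11 χ) (a21 χ) - (L2 * SF + L2 * SG)) + (L2 * SF - (frakA χ : ℂ) * IF) +
        ((L2 * SG1 - (frakA χ : ℂ) * IG1) - (L2 * SG2 - (frakA χ : ℂ) * IG2))‖
      ≤ ‖Sj c' D j (a11 χ) (a21 χ) - (L2 * SF + L2 * SG)‖ + ‖L2 * SF - (frakA χ : ℂ) * IF‖ +
        ‖(L2 * SG1 - (frakA χ : ℂ) * IG1) - (L2 * SG2 - (frakA χ : ℂ) * IG2)‖ := norm_add₃_le
    _ ≤ ε / 2 * alpha D + |C| * (423400 + 2674500 * π) / ell D ^ 12 +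
        (|C| * (16936 + 106980 * π) / ell D ^ 12 + |C| * (16936 + 106980 * π) / ell D ^ 12) :=
        add_le_add (add_le_add e46' engF') ((norm_sub_le _ _).trans (add_le_add engG1' engG2'))
    _ = ε / 2 * alpha D + |C| * Q / ell D ^ 12 := by rw [hQ]; ring
    _ ≤ ε / 2 * alpha D + ε / 2 * alpha D := by rw [hα]; exact add_le_add le_rfl htot
    _ = ε * alpha D := by ring

/-- **`Section8cStatements.Ded811 c′` HOLDS** (the typed deduction `Step8u046 → Step8u047 →
Step8u048 → Eq811`; its last two antecedents are not needed — the engine consumes the kernel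
theorems `step8u047_holds` and the tree's polynomial-error `[T,1.2.12]` mean value instead of the
printed `O(log 𝓛)` form of `Step8u048`). [cite: Zhang2022LandauSiegel, §8 (8.11) p.48, tex L2466] -/
theorem ded811_holds (c' : ℝ) : Ded811 c' := fun h46 _ _ => eq811_of_step8u046 c' h46

variable (c' : ℝ) in
/-- `Ded811` — `_holds` alias of `ded811_holds` above under the fact's exact name, stated under the
prover's own binders as section variables (appended 2026-08-28, D-0026 bookkeeping: the proof term is the
existing theorem of this file; no statement, definition or attribute is edited; no new named fact; the
ledger's debt table listed the fact unproved). [cite: Zhang2022LandauSiegel, §8 (8.11) p.48, tex L2466] -/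
theorem _root_.Literature.NumberTheory.LFunctions.Zhang2022.Section8cStatements.Ded811_holds :
    _root_.Literature.NumberTheory.LFunctions.Zhang2022.Section8cStatements.Ded811 c' :=
  _root_.Literature.NumberTheory.LFunctions.Zhang2022.Section8Ded811Engine.ded811_holds (c' := c')

end Literature.NumberTheory.LFunctions.Zhang2022.Section8Ded811Engine
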